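import Mathlib

/-!
# Continuants of the tridiagonal Toeplitz pencil (Chebyshev polynomials in `x` and `w = yz`)

Crux `ValuativeGCT.ValuativeFlip` (stmt-ValiantsHypothesis-12624), wall-breaker axis 14
("plethysm tables, small cases certified"), gen 1: row 3 of the few-row table
(ternary forms are border-determinantal), file 1 of 4.

The *continuant* `θ_k ∈ ℂ[x, y, z]` is the determinant of the `k × k` tridiagonal Toeplitz matrix
with `x` on the diagonal, `y` above and `z` below it: `θ₀ = 1`, `θ₁ = x`,
`θ_{k+2} = x θ_{k+1} - yz θ_k` (a Chebyshev polynomial of the second kind in `x` and `w = yz`).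
This file is pure polynomial algebra in `MvPolynomial (Fin 3) ℂ` (`x = X 0`, `y = X 1`,
`z = X 2`):

* `tco_add_add_two` — the addition formula `θ_{a+b+2} = θ_{a+1} θ_{b+1} - w θ_a θ_b`;
* `tco_mul_sub` — the linearisation step `θ_{p+1} θ_{p+d+1} - θ_p θ_{p+d+2} = w^{p+1} θ_d`;
* `tco_X_pow_mul_w_pow_mem` — **triangularity**: every monomial `x^k w^c` lies in the `ℂ`-span
  `tcoSpan (k + 2c)` of the products `θ_p θ_q`, `p + q = k + 2c` (the products are unitriangular
  in the basis `w^c θ_{L-2c}` of the weighted-degree-`L` part of `ℂ[x, w]`).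

These feed the cofactor formula `adj(T)_{ij} = (-y)^{j-i} θ_i θ_{m-1-j}` of the tridiagonal pencil
and the spanning property of its cofactors (file `…TridiagonalAdjugate`), whence the submersion of
`(A, B, C) ↦ det(xA + yB + zC)` at that pencil and the border-determinantal expression of every
ternary form (files `…DetPencilSubmersion`, `…TernaryFormsBorderDeterminantal`).

References: classical (continuants / Chebyshev polynomials `U_p U_q = Σ U_{q-p+2k}`);
R. A. Usmani, *Inversion of a tridiagonal Jacobi matrix*, Linear Algebra Appl. 212/213 (1994).
-/

set_option linter.dupNamespace false

namespace Summit.ValiantsHypothesis.ValiantsHypothesis.Theorems.ValuativeFlip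

open MvPolynomial
open scoped BigOperators

noncomputable section

/-- The continuant `θ_k`: determinant of the `k × k` tridiagonal Toeplitz matrix `(x; y above; z
below)`, defined by `θ₀ = 1`, `θ₁ = x`, `θ_{k+2} = x θ_{k+1} - y z θ_k` in `ℂ[X₀, X₁, X₂]`.
[classical] -/
def tco : ℕ → MvPolynomial (Fin 3) ℂ
  | 0 => 1
  | 1 => X 0
  | (k + 2) => X 0 * tco (k + 1) - X 1 * X 2 * tco k

/-- `θ₀ = 1`. [classical] -/
@[simp] theorem tco_zero : tco 0 = 1 := rfl

/-- `θ₁ = x`. [classical] -/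
@[simp] theorem tco_one : tco 1 = X 0 := rfl

/-- The three-term recursion `θ_{k+2} = x θ_{k+1} - yz θ_k`. [classical] -/
theorem tco_add_two (k : ℕ) : tco (k + 2) = X 0 * tco (k + 1) - X 1 * X 2 * tco k := rfl

/-- The recursion with the indices supplied as equations (robust rewriting form). [classical] -/
theorem tco_rec {a b c : ℕ} (hb : b = a + 1) (hc : c = a + 2) :
    tco c = X 0 * tco b - X 1 * X 2 * tco a := by
  subst hb; subst hc; rfl

/-- `θ_k(1, 0, 0) = 1`: the continuants do not vanish. [classical] -/
theorem eval_tco_axis (k : ℕ) :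
    eval (fun t : Fin 3 => if t = 0 then (1 : ℂ) else 0) (tco k) = 1 := by
  induction k using Nat.twoStepInduction with
  | zero => simp
  | one => simp
  | more k ih1 ih2 =>
    rw [tco_add_two, map_sub, map_mul, map_mul, map_mul, ih1, ih2]
    simp

/-- `θ_k ≠ 0`. [classical] -/
theorem tco_ne_zero (k : ℕ) : tco k ≠ 0 := by
  intro h
  have := eval_tco_axis k
  rw [h, map_zero] at this
  exact zero_ne_one this

/-- **Addition formula** `θ_{a+b+2} = θ_{a+1} θ_{b+1} - yz θ_a θ_b` (Chebyshev
`U_{a+b} = U_a U_b - U_{a-1} U_{b-1}`). [classical] -/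
theorem tco_add_add_two (a b : ℕ) :
    tco (a + b + 2) = tco (a + 1) * tco (b + 1) - X 1 * X 2 * (tco a * tco b) := by
  induction a generalizing b with
  | zero =>
    rw [tco_rec (a := b) (b := b + 1) (c := 0 + b + 2) rfl (by omega), tco_zero,
      show (0 : ℕ) + 1 = 1 from rfl, tco_one]
    ring
  | succ a ih =>
    rw [show a + 1 + b + 2 = a + (b + 1) + 2 by omega, ih (b + 1),
      tco_rec (a := b) (b := b + 1) (c := b + 1 + 1) rfl rfl,
      tco_rec (a := a) (b := a + 1) (c := a + 1 + 1) rfl rfl]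
    ring

/-- **Linearisation step** `θ_{p+1} θ_{p+d+1} - θ_p θ_{p+d+2} = w^{p+1} θ_d` (`w = yz`): the products
`θ_p θ_{L-p}` are unitriangular in the basis `w^c θ_{L-2c}`. [classical] -/
theorem tco_mul_sub (p d : ℕ) :
    tco (p + 1) * tco (p + d + 1) - tco p * tco (p + d + 2) = (X 1 * X 2) ^ (p + 1) * tco d := by
  induction p with
  | zero =>
    rw [tco_rec (a := d) (b := 0 + d + 1) (c := 0 + d + 2) (by omega) (by omega), tco_zero,
      show (0 : ℕ) + 1 = 1 from rfl, tco_one]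
    ring
  | succ p ih =>
    rw [tco_rec (a := p + d + 1) (b := p + d + 2) (c := p + 1 + d + 2) (by omega) (by omega),
      tco_rec (a := p) (b := p + 1) (c := p + 1 + 1) rfl rfl,
      show p + 1 + d + 1 = p + d + 2 by omega]
    linear_combination (X 1 * X 2 : MvPolynomial (Fin 3) ℂ) * ih

/-! ## Spans of products `θ_p θ_q` and triangularity -/

/-- The generating set `{θ_p θ_q : p + q = L}`. [this file] -/
def tcoGen (L : ℕ) : Set (MvPolynomial (Fin 3) ℂ) :=
  {f | ∃ p q : ℕ, p + q = L ∧ f = tco p * tco q}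

/-- `tcoSpan L = span_ℂ {θ_p θ_q : p + q = L}`. [this file] -/
def tcoSpan (L : ℕ) : Submodule ℂ (MvPolynomial (Fin 3) ℂ) :=
  Submodule.span ℂ (tcoGen L)

/-- Membership of a generator. [this file] -/
theorem tco_mul_tco_mem_tcoSpan {p q L : ℕ} (h : p + q = L) : tco p * tco q ∈ tcoSpan L :=
  Submodule.subset_span ⟨p, q, h, rfl⟩

/-- Multiplying a member of a span into another span, generator by generator. [folklore] -/
theorem mul_mem_span_of_forall_mul_mem {r f : MvPolynomial (Fin 3) ℂ}
    {S T : Set (MvPolynomial (Fin 3) ℂ)} (hf : f ∈ Submodule.span ℂ S)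
    (h : ∀ s ∈ S, r * s ∈ Submodule.span ℂ T) : r * f ∈ Submodule.span ℂ T := by
  induction hf using Submodule.span_induction with
  | mem s hs => exact h s hs
  | zero => simp
  | add a b _ _ ha hb => rw [mul_add]; exact add_mem ha hb
  | smul c a _ ha => rw [mul_smul_comm]; exact Submodule.smul_mem _ c ha

/-- `w^c θ_k ∈ tcoSpan (k + 2c)`: for `c ≥ 1` it is the difference of the two generators in
`tco_mul_sub`. [this file] -/
theorem w_pow_mul_tco_mem_tcoSpan (c k : ℕ) :
    (X 1 * X 2) ^ c * tco k ∈ tcoSpan (k + 2 * c) := by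
  rcases c with _ | c
  · simpa using tco_mul_tco_mem_tcoSpan (p := 0) (q := k) (L := k + 2 * 0) (by omega)
  · rw [← tco_mul_sub c k]
    exact sub_mem (tco_mul_tco_mem_tcoSpan (by omega)) (tco_mul_tco_mem_tcoSpan (by omega))

/-- The lower-order generators `{x^{k-2s} w^s : 1 ≤ s, 2s ≤ k}`. [this file] -/
def tcoLowGen (k : ℕ) : Set (MvPolynomial (Fin 3) ℂ) :=
  {f | ∃ s : ℕ, 1 ≤ s ∧ 2 * s ≤ k ∧ f = X 0 ^ (k - 2 * s) * (X 1 * X 2) ^ s}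

/-- **`θ_k = x^k +` lower order**: `θ_k - x^k` is a `ℂ`-combination of the monomials `x^{k-2s} w^s`,
`s ≥ 1`. [classical] -/
theorem tco_sub_X_pow_mem (k : ℕ) : tco k - X 0 ^ k ∈ Submodule.span ℂ (tcoLowGen k) := by
  induction k using Nat.twoStepInduction with
  | zero => simp
  | one => simp
  | more k ih1 ih2 =>
    have hdecomp : tco (k + 2) - X 0 ^ (k + 2) =
        X 0 * (tco (k + 1) - X 0 ^ (k + 1)) - X 1 * X 2 * (tco k - X 0 ^ k)
          - X 0 ^ k * (X 1 * X 2) := by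
      rw [tco_add_two]; ring
    rw [hdecomp]
    refine sub_mem (sub_mem ?_ ?_) ?_
    · refine mul_mem_span_of_forall_mul_mem ih2 fun s hs => ?_
      obtain ⟨s, hs1, hs2, rfl⟩ := hs
      refine Submodule.subset_span ⟨s, hs1, by omega, ?_⟩
      rw [show k + 2 - 2 * s = (k + 1 - 2 * s) + 1 by omega, pow_succ]
      ring
    · refine mul_mem_span_of_forall_mul_mem ih1 fun s hs => ?_
      obtain ⟨s, hs1, hs2, rfl⟩ := hs
      refine Submodule.subset_span ⟨s + 1, by omega, by omega, ?_⟩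
      rw [show k + 2 - 2 * (s + 1) = k - 2 * s by omega, pow_succ]
      ring
    · refine Submodule.subset_span ⟨1, le_rfl, by omega, ?_⟩
      rw [show k + 2 - 2 * 1 = k by omega, pow_one]

/-- **Triangularity / spanning**: every monomial `x^k w^c` of `ℂ[x, w]` lies in the span of the
products `θ_p θ_q` with `p + q = k + 2c`. (So `{θ_p θ_{L-p}}` spans the weighted-degree-`L` part
of `ℂ[x, w]`.) [classical] -/
theorem tco_X_pow_mul_w_pow_mem : ∀ k c : ℕ, (MvPolynomial.X 0 ^ k * (MvPolynomial.X 1 * MvPolynomial.X 2) ^ c : MvPolynomial (Fin 3) ℂ) ∈ tcoSpan (k + 2 * c) := by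
  intro k
  induction k using Nat.strong_induction_on with
  | _ k ih =>
    intro c
    have h1 : (X 1 * X 2) ^ c * tco k ∈ tcoSpan (k + 2 * c) := w_pow_mul_tco_mem_tcoSpan c k
    have h3 : (X 1 * X 2) ^ c * (tco k - X 0 ^ k) ∈ tcoSpan (k + 2 * c) := by
      refine mul_mem_span_of_forall_mul_mem (tco_sub_X_pow_mem k) fun s hs => ?_
      obtain ⟨s, hs1, hs2, rfl⟩ := hs
      have h := ih (k - 2 * s) (by omega) (c + s)
      rw [show k - 2 * s + 2 * (c + s) = k + 2 * c by omega] at h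
      have heq : ((X 1 * X 2) ^ c * (X 0 ^ (k - 2 * s) * (X 1 * X 2) ^ s) :
          MvPolynomial (Fin 3) ℂ) = X 0 ^ (k - 2 * s) * (X 1 * X 2) ^ (c + s) := by ring
      rw [heq]
      exact h
    have hdecomp : (X 0 ^ k * (X 1 * X 2) ^ c : MvPolynomial (Fin 3) ℂ) =
        (X 1 * X 2) ^ c * tco k - (X 1 * X 2) ^ c * (tco k - X 0 ^ k) := by ring
    rw [hdecomp]
    exact sub_mem h1 h3

end

end Summit.ValiantsHypothesis.ValiantsHypothesis.Theorems.ValuativeFlip
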